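import Literature.MathematicalPhysics.QuantumFieldTheory.Balaban1983to89.B8SectEKLevelDomains
import Literature.MathematicalPhysics.QuantumFieldTheory.Balaban1983to89.B8ConstraintBonds

/-!
# `Balaban1983to89.B8SectEKLevelDomainSeq` — [Balaban1985RegularSpaces] Sect. E at `k` levels: the geometric clause «`Bʲ(y) ⊂ Ω_j` for
# `y ∈ Λ_j`» of `B8SectEKLevelDomains` DISCHARGED from the admissibility record (1.3)/(1.4) (`B8ConstraintBonds.DomainSeq`: each `Ω_j` a
# union of `j`-blocks) and «`Λ_j ⊂ Ω_j^{(j)}`» — so that `D′`, (1.114) and the p. 97 onto sentence on `𝔅_k` are stated for a sequence of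
# domains `{Ω_j}` exactly as print has them

statement-level skeleton of published theorems with citation tags; proofs where landed; nothing here is a claim about the Yang–Mills mass gap

T. Bałaban, *Spaces of regular gauge field configurations on a lattice and gauge fixing conditions*, Commun.
Math. Phys. **99** (1985) 75–102 `[Balaban1985RegularSpaces]` ("B8"; printed page = PDF page + 74), p. 77 ((1.3)–(1.5)), pp. 95–97.  PDF
held: `paper:balaban1985-cmp99-regular-spaces-gauge-fixing`.  STATUS: published, refereed.

CITATION HEADER (lean-in-tree rule).  Cell `pub-ymgap` (YM Track A, DAG node N05 = [B8], HUMAN RULING D-0062), seat `pub-ymgap-dag-n05-b`,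
gen 0 («Sect. E at k levels»).  WHAT IS REPRODUCED = the bookkeeping sentence of p. 77 «(1.3) Ω_j ⊃ Ω_{j+1} … (1.4) Ω_j is a union of big
blocks … 𝔅_k = ⋃_j Λ_j, Λ_j ⊂ Ω_j^{(j)}» in the form Sect. E consumes: a site of the `j`-block tower `Bʲ(y)` (`B8Ineq130.tlo/thi`) has
`j`-block index `y` (`QuantumLattice.blockMap` of `BalabanRG`), so by the saturation clause `sat` of `B8ConstraintBonds.DomainSeq` the whole
tower lies in `Ω_j` as soon as its base corner `Lʲy` does («`y ∈ Ω_j^{(j)}`»).  Then `B8SectEKLevelDomains.{exists_Dprime_kLevel_of_domains,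
onto_kLevel_of_domains}` are restated with the clause replaced by `DomainSeq L Ω` + `Lʲy ∈ Ω_j` for `y ∈ Λ_j` (cf. this seat's
`B8Eq156KLevelLocal.hbox_of_domainSeq` for the two-block boxes of (1.56)).  Kind «kernel-checked proof», theorems only: no `def`, no
`… : Prop` fact, no existing module modified.  REUSED BY NAME: `B8ConstraintBonds.DomainSeq(.sat)`, `QuantumLattice.blockMap`,
`B8Ineq130.{tlo, thi, tlo_apply, thi_apply, tlo_le_thi}`, `B8SectEKLevelDomains.{exists_Dprime_kLevel_of_domains, onto_kLevel_of_domains}`.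

## WHAT IS CERTIFIED HERE (kernel; axioms `propext` / `Classical.choice` / `Quot.sound`)

* §1 `blockMap_of_inBox_tower` — a site `x` of the tower `[tlo L y j, thi L y j] = Bʲ(y)` has `blockMap (Lʲ) x = y`;
  `mem_of_inBox_tower_of_domainSeq` — under `DomainSeq L Ω`, `Lʲy ∈ Ω_j` ⇒ `Bʲ(y) ⊂ Ω_j`; `hbox_of_domainSeq_towers` — the geometric clause of
  `B8SectEKLevelDomains` for all `y ∈ Λ_j`, `j ≤ k`.
* §2 **`exists_Dprime_kLevel_of_domainSeq`**, **`onto_kLevel_of_domainSeq`** — `D′` + (1.114) on `𝔅_k` and the p. 97 onto sentence at `k`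
  levels for a SEQUENCE OF DOMAINS `{Ω_j}` ((1.3)/(1.4)) with `Λ_j ⊂ Ω_j^{(j)}`, hypotheses «on Ω_j» as printed.

## HONEST SCOPE — what is NOT claimed

`Λ_j ⊂ Ω_j^{(j)}` is read as «the base corner `Lʲy` of the block of `y` lies in `Ω_j`» (equivalent under `sat`); everything else as in
`B8SectEKLevelDomains` / `B8Eq1117KLevel` / `B8Claim97KLevel` (their HONEST SCOPE).  Nothing here is progress on the summit.
-/

noncomputable section

open NormedSpace Finset

namespace Literature.MathematicalPhysics.QuantumFieldTheory.Balaban1983to89.B8SectEKLevelDomainSeq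

open B7Prop1Explicit B7Prop2Explicit B7Prop3Flat B7Prop1Local B7Eq167Flat B7Eq167General
open B7Eq170Flat (cj cj_apply)
open B7Prop10General (C6 C4G)
open B7Prop9Flat (C5')
open B7Eq214General (Cgen)
open B8Ineq130 (tlo thi tlo_apply thi_apply)
open B7Eq84Concrete (glev)
open B7Eq92Concrete (mgauge)
open B7Eq78Linearization (zdBlocking QprimeIter)
open B8Eq119TwistedAxial (bgT InAx Restr129)
open B8Eq178Averages (Qnl)
open B8Eq1123Concrete (Cnl)
open B8Ineq125Concrete (C2p)
open B8Eq1117Concrete (XSpace)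
open B8Ineq132 (InAk BondTouches)
open B8ConstraintBonds (DomainSeq)
open Literature.MathematicalPhysics.QuantumLattice (blockMap)
open B8SectEKLevelDomains (exists_Dprime_kLevel_of_domains onto_kLevel_of_domains)

-- `Site` alone could resolve to the torus sites of `Setup.lean`; re-export the `ℤ^d` sites of `B7Prop1Explicit`.
export B7Prop1Explicit (Site)

variable {d : ℕ}

/-! ## §1 The tower `Bʲ(y)` lies in `Ω_j` when its base corner does -/

section Tower

/-- `a / P = w ↔ P·w ≤ a < P·w + P` for `P > 0` (integer division). [folklore] -/
private theorem ediv_eq_iff_of_pos {P : ℤ} (hP : 0 < P) {a w : ℤ} : a / P = w ↔ P * w ≤ a ∧ a < P * w + P := by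
  rw [le_antisymm_iff, ← Int.lt_add_one_iff, Int.ediv_lt_iff_lt_mul hP, Int.le_ediv_iff_mul_le hP]
  have h1 : (w + 1) * P = P * w + P := by ring
  have h2 : w * P = P * w := mul_comm _ _
  rw [h1, h2]
  exact and_comm

/-- **A site of the tower `Bʲ(y) = [tlo L y j, thi L y j]` has `j`-block index `y`**: `blockMap (Lʲ) x = y` (`L ≥ 1`).
[cite: Balaban1985RegularSpaces, (1.4)–(1.5) p.77] -/
theorem blockMap_of_inBox_tower {L : ℕ} (hL : 1 ≤ L) (j : ℕ) (y : Site d) {x : Site d}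
    (hx : InBox (tlo L y j) (thi L y j) x) : blockMap (L ^ j) x = y := by
  have hP : (0 : ℤ) < (L : ℤ) ^ j := by positivity
  have hPc : ((L ^ j : ℕ) : ℤ) = (L : ℤ) ^ j := by push_cast; rfl
  funext i
  show x i / ((L ^ j : ℕ) : ℤ) = y i
  rw [hPc, ediv_eq_iff_of_pos hP]
  have h1 := (hx i).1
  have h2 := (hx i).2
  rw [tlo_apply] at h1
  rw [thi_apply] at h2
  constructor
  · exact h1
  · have : (L : ℤ) ^ j * (y i + 1) - 1 < (L : ℤ) ^ j * y i + (L : ℤ) ^ j := by linarith [mul_add ((L : ℤ) ^ j) (y i) 1]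
    exact lt_of_le_of_lt h2 this

/-- **`Bʲ(y) ⊂ Ω_j` when `Lʲy ∈ Ω_j`** under the admissibility record (1.3)/(1.4) (`DomainSeq`: `Ω_j` is a union of `j`-blocks, clause `sat`):
every site of the tower over `y` lies in `Ω_j`. [cite: Balaban1985RegularSpaces, (1.3)–(1.5) p.77] -/
theorem mem_of_inBox_tower_of_domainSeq {L : ℕ} (hL : 1 ≤ L) {Ω : ℕ → Set (Site d)} (hΩ : DomainSeq L Ω) {j : ℕ} {y : Site d}
    (hy : tlo L y j ∈ Ω j) {x : Site d} (hx : InBox (tlo L y j) (thi L y j) x) : x ∈ Ω j := by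
  have hcorner : InBox (tlo L y j) (thi L y j) (tlo L y j) := fun i => ⟨le_rfl, B8Ineq130.tlo_le_thi hL le_rfl j i⟩
  exact hΩ.sat j (tlo L y j) x (by rw [blockMap_of_inBox_tower hL j y hcorner, blockMap_of_inBox_tower hL j y hx]) hy

/-- **The geometric clause of `B8SectEKLevelDomains` from `DomainSeq` + «Λ_j ⊂ Ω_j^{(j)}»** (base corners `Lʲy ∈ Ω_j`).
[cite: Balaban1985RegularSpaces, (1.3)–(1.5) p.77, p.81 (𝔅_k = ⋃ Λ_j)] -/
theorem hbox_of_domainSeq_towers {L : ℕ} (hL : 1 ≤ L) {Ω : ℕ → Set (Site d)} (hΩ : DomainSeq L Ω) {k : ℕ} {Λ : ℕ → Set (Site d)}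
    (hΛ : ∀ j, j ≤ k → ∀ y ∈ Λ j, tlo L y j ∈ Ω j) :
    ∀ j, j ≤ k → ∀ y ∈ Λ j, ∀ x : Site d, InBox (tlo L y j) (thi L y j) x → x ∈ Ω j :=
  fun j hj y hy _ hx => mem_of_inBox_tower_of_domainSeq hL hΩ (hΛ j hj y hy) hx

end Tower

/-! ## §2 Sect. E at `k` levels for a sequence of domains `{Ω_j}` -/

section DomainSeqForms

variable {𝔸 : Type*} [NormedRing 𝔸] [NormOneClass 𝔸] [NormedAlgebra ℂ 𝔸] [CompleteSpace 𝔸]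

/-- **`D′(λ)` AND (1.114) ON `𝔅_k` FOR A SEQUENCE OF DOMAINS** — `B8SectEKLevelDomains.exists_Dprime_kLevel_of_domains` with the geometric
clause discharged from `DomainSeq L Ω` ((1.3)/(1.4)) and `Lʲy ∈ Ω_j` for `y ∈ Λ_j` («Λ_j ⊂ Ω_j^{(j)}»).
[cite: Balaban1985RegularSpaces, (1.113)–(1.121) pp.95–97, (1.3)–(1.5) p.77, (1.33) p.82, (1.69) p.88] -/
theorem exists_Dprime_kLevel_of_domainSeq {L : ℕ} (hL : 2 ≤ L) (hL1 : 1 ≤ L) {G : Subgroup 𝔸ˣ} (hG : AvgClosed d L G)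
    {U₀ : Site d → Fin d → 𝔸ˣ} (hU₀ : ∀ x κ, U₀ x κ ∈ G) {k : ℕ} {Ω Λ : ℕ → Set (Site d)} (hΩ : DomainSeq L Ω)
    (hΛ : ∀ j, j ≤ k → ∀ y ∈ Λ j, tlo L y j ∈ Ω j) {η : ℝ}
    (H' : XSpace d k 𝔸 →ₗ[ℂ] (Site d → 𝔸)) (lam : Site d → 𝔸) {B : Site d → Fin d → 𝔸} {u₁ : Site d → 𝔸ˣ}
    {α₀ α₄ c B₀' : ℝ}
    (hα : 0 < α₀) (hα3 : C0 d * α₀ ≤ 1 / 3) (hα4 : 4 * α₀ ≤ c2' d L) (hc : 0 ≤ c) (hα₄ : 0 < α₄) (hB : 0 < B₀')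
    (h33 : InAk L k η α₀ Ω U₀)
    (h69 : ∀ j, j ≤ k → ∀ (x : Site d) (κ : Fin d), BondTouches (Ω j) x κ → ‖B x κ‖ ≤ c * ((L : ℝ) ^ j)⁻¹)
    (hAx : InAx L k Λ U₀ (mgauge U₀ u₁ (expCfg B) * U₀)) (h129 : Restr129 L k Λ U₀ u₁)
    (h119b : ∀ j, j ≤ k → ∀ x : Site d, x ∈ Ω j → ‖lam x‖ < α₄ / 2)
    (h119a : ∀ j, j ≤ k → ∀ (x : Site d) (κ : Fin d), BondTouches (Ω j) x κ →
      ‖cj (U₀ x κ) (lam (x + e κ)) - lam x‖ < α₄ / 2 * ((L : ℝ) ^ j)⁻¹)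
    (hH0 : ∀ (X : XSpace d k 𝔸) (x : Site d), ‖H' X x‖ ≤ B₀' * ‖X‖)
    (hH1 : ∀ j, j ≤ k → ∀ (X : XSpace d k 𝔸) (x : Site d) (κ : Fin d), BondTouches (Ω j) x κ →
      ‖cj (U₀ x κ) (H' X (x + e κ)) - H' X x‖ ≤ B₀' * ‖X‖ * ((L : ℝ) ^ j)⁻¹)
    (hQH : ∀ (Y : XSpace d k 𝔸) (j : ℕ) (hj : j ≤ k) (y : Site d), y ∈ Λ j →
      QprimeIter (zdBlocking d L) (bgT L U₀) j (H' Y) y = Y (⟨j, Nat.lt_succ_of_le hj⟩, y))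
    (hsmall : Real.exp (4 * (800 * ((d : ℝ) + 1) ^ 2 * ((d : ℝ) + 4)) * α₀) * (1 + 8 * (131072 * ((d : ℝ) + 1) ^ 2) * c) ≤ 2)
    (hc₃ : 2 * c ≤ c3 d L) (hs : 128 * (d : ℝ) * c ≤ 1) (hα₃' : 40 * d * c ≤ 1 / 200)
    (hs₁ : 200 * C6 d * (2 * α₄) ≤ 1) (hs₂ : 12000 * ((d : ℝ) + 1) * L * (2 * α₄) ≤ 1)
    (hs₃ : C4G d L * (α₀ + 40 * d * c + 4 * (2 * α₄)) ≤ 1)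
    (hs₄ : 1024 * ((d : ℝ) + 1) * ((d : ℝ) + 4) * L ^ 2 * α₀ ≤ 1) (hs₅ : 32 * ((d : ℝ) + 1) ^ 2 * C6 d * L ^ 2 * α₀ ≤ 1)
    (hs₆ : 16 * d * C5' d * C6 d * (L : ℝ) ^ 2 * α₀ ≤ 1) (hs₇ : 8 * d * C6 d * L * α₀ ≤ 1)
    (hsm : 40 * d * c + α₄ ≤ 1 / (4 * B₀' * (2 * C2p d))) :
    ∃ X : XSpace d k 𝔸, ‖X‖ ≤ α₄ / (2 * B₀') ∧ ‖X‖ ≤ C2p d * (40 * d * c + α₄) * α₄ ∧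
      (∀ (j : ℕ) (hj : j ≤ k) (y : Site d), y ∉ Λ j → X (⟨j, Nat.lt_succ_of_le hj⟩, y) = 0) ∧
      (∀ (j : ℕ) (hj : j ≤ k) (y : Site d), y ∈ Λ j →
        Cnl L U₀ u₁ j (lam - H' X) y = X (⟨j, Nat.lt_succ_of_le hj⟩, y)) ∧
      ∀ (j : ℕ), j ≤ k → ∀ y ∈ Λ j,
        Qnl L U₀ (fun x => expUnit ((lam - H' X) x)) u₁ j y = QprimeIter (zdBlocking d L) (bgT L U₀) j lam y :=
  exists_Dprime_kLevel_of_domains hL hL1 hG hU₀ Ω Λ H' lam hα hα3 hα4 hc hα₄ hB (hbox_of_domainSeq_towers hL1 hΩ hΛ) h33 h69 hAx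
    h129 h119b h119a hH0 hH1 hQH hsmall hc₃ hs hα₃' hs₁ hs₂ hs₃ hs₄ hs₅ hs₆ hs₇ hsm

/-- **THE p. 97 ONTO SENTENCE AT `k` LEVELS FOR A SEQUENCE OF DOMAINS** — `B8SectEKLevelDomains.onto_kLevel_of_domains` with the geometric
clause discharged from `DomainSeq L Ω` and `Lʲy ∈ Ω_j` for `y ∈ Λ_j`.
[cite: Balaban1985RegularSpaces, p.97 (onto sentence), (1.113) p.95, (1.3)–(1.5) p.77] -/
theorem onto_kLevel_of_domainSeq {L : ℕ} (hL : 2 ≤ L) (hL1 : 1 ≤ L) {G : Subgroup 𝔸ˣ} (hG : AvgClosed d L G)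
    {U₀ : Site d → Fin d → 𝔸ˣ} (hU₀ : ∀ x κ, U₀ x κ ∈ G) {k : ℕ} {Ω Λ : ℕ → Set (Site d)} (hΩ : DomainSeq L Ω)
    (hΛ : ∀ j, j ≤ k → ∀ y ∈ Λ j, tlo L y j ∈ Ω j) {η : ℝ}
    (H' : XSpace d k 𝔸 →ₗ[ℂ] (Site d → 𝔸)) (lam' : Site d → 𝔸) {B : Site d → Fin d → 𝔸} {u₁ : Site d → 𝔸ˣ}
    {α₀ α₄ c B₀' : ℝ}
    (hα : 0 < α₀) (hα3 : C0 d * α₀ ≤ 1 / 3) (hα4 : 4 * α₀ ≤ c2' d L) (hc : 0 ≤ c) (hα₄ : 0 < α₄) (hB : 0 < B₀')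
    (h33 : InAk L k η α₀ Ω U₀)
    (h69 : ∀ j, j ≤ k → ∀ (x : Site d) (κ : Fin d), BondTouches (Ω j) x κ → ‖B x κ‖ ≤ c * ((L : ℝ) ^ j)⁻¹)
    (hAx : InAx L k Λ U₀ (mgauge U₀ u₁ (expCfg B) * U₀)) (h129 : Restr129 L k Λ U₀ u₁)
    (hq_b : ∀ j, j ≤ k → ∀ x : Site d, x ∈ Ω j → ‖lam' x‖ < α₄ / 4)
    (hq_a : ∀ j, j ≤ k → ∀ (x : Site d) (κ : Fin d), BondTouches (Ω j) x κ →
      ‖cj (U₀ x κ) (lam' (x + e κ)) - lam' x‖ < α₄ / 4 * ((L : ℝ) ^ j)⁻¹)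
    (hH0 : ∀ (X : XSpace d k 𝔸) (x : Site d), ‖H' X x‖ ≤ B₀' * ‖X‖)
    (hH1 : ∀ j, j ≤ k → ∀ (X : XSpace d k 𝔸) (x : Site d) (κ : Fin d), BondTouches (Ω j) x κ →
      ‖cj (U₀ x κ) (H' X (x + e κ)) - H' X x‖ ≤ B₀' * ‖X‖ * ((L : ℝ) ^ j)⁻¹)
    (hsmall : Real.exp (4 * (800 * ((d : ℝ) + 1) ^ 2 * ((d : ℝ) + 4)) * α₀) * (1 + 8 * (131072 * ((d : ℝ) + 1) ^ 2) * c) ≤ 2)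
    (hc₃ : 2 * c ≤ c3 d L) (hs : 128 * (d : ℝ) * c ≤ 1) (hα₃' : 40 * d * c ≤ 1 / 200)
    (hs₁ : 200 * C6 d * (2 * α₄) ≤ 1) (hs₂ : 12000 * ((d : ℝ) + 1) * L * (2 * α₄) ≤ 1)
    (hs₃ : C4G d L * (α₀ + 40 * d * c + 4 * (2 * α₄)) ≤ 1)
    (hs₄ : 1024 * ((d : ℝ) + 1) * ((d : ℝ) + 4) * L ^ 2 * α₀ ≤ 1) (hs₅ : 32 * ((d : ℝ) + 1) ^ 2 * C6 d * L ^ 2 * α₀ ≤ 1)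
    (hs₆ : 16 * d * C5' d * C6 d * (L : ℝ) ^ 2 * α₀ ≤ 1) (hs₇ : 8 * d * C6 d * L * α₀ ≤ 1)
    (hsm : 40 * d * c + α₄ ≤ 1 / (4 * B₀' * (2 * C2p d))) :
    ∃ (lam : Site d → 𝔸) (X : XSpace d k 𝔸),
      (∀ j, j ≤ k → ∀ y ∈ Λ j, ∀ x : Site d, InBox (tlo L y j) (thi L y j) x → ‖lam x‖ < α₄ / 2) ∧
      (∀ j, j ≤ k → ∀ y ∈ Λ j, ∀ (x : Site d) (κ : Fin d), InBox (tlo L y j) (thi L y j) x →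
        InBox (tlo L y j) (thi L y j) (x + e κ) → ‖cj (U₀ x κ) (lam (x + e κ)) - lam x‖ < α₄ / 2 * ((L : ℝ) ^ j)⁻¹) ∧
      ‖X‖ ≤ α₄ / (2 * B₀') ∧
      (∀ (j : ℕ) (hj : j ≤ k) (y : Site d), y ∉ Λ j → X (⟨j, Nat.lt_succ_of_le hj⟩, y) = 0) ∧
      (∀ (j : ℕ) (hj : j ≤ k) (y : Site d), y ∈ Λ j →
        Cnl L U₀ u₁ j (lam - H' X) y = X (⟨j, Nat.lt_succ_of_le hj⟩, y)) ∧
      lam - H' X = lam' :=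
  onto_kLevel_of_domains hL hL1 hG hU₀ Ω Λ H' lam' hα hα3 hα4 hc hα₄ hB (hbox_of_domainSeq_towers hL1 hΩ hΛ) h33 h69 hAx h129 hq_b
    hq_a hH0 hH1 hsmall hc₃ hs hα₃' hs₁ hs₂ hs₃ hs₄ hs₅ hs₆ hs₇ hsm

end DomainSeqForms

#print axioms blockMap_of_inBox_tower
#print axioms mem_of_inBox_tower_of_domainSeq
#print axioms exists_Dprime_kLevel_of_domainSeq
#print axioms onto_kLevel_of_domainSeq

end Literature.MathematicalPhysics.QuantumFieldTheory.Balaban1983to89.B8SectEKLevelDomainSeq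

end
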